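import Summits.AtomisticToContinuum.FouriersLaw.Theorems.PhononMeanFreePathDefs
import Summits.AtomisticToContinuum.FouriersLaw.Theorems.BondHeatUncertaintySubdiffusiveBondHeatKernelDetailedBalance
import Summits.AtomisticToContinuum.FouriersLaw.Theorems.PhononMeanFreePathIncoherentChannelLightConeHelper2

/-!
# Time reversal of the mean forecast (line `two-horizons-forecast-loss`, crux `IncoherentChannel`)

Helper file of line `two-horizons-forecast-loss` of crux `PhononMeanFreePath.IncoherentChannel`
(stmt-AtomisticToContinuum-11811), stub group "TimeReversal".

Setting: `P = pinnedChain ω₂ lam β γ` (`ω₂, lam, β, γ > 0`), the `(N+1)`-site chain `0..N` with both baths at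
`T > 0`, `μ₀ = P.gibbsMeasure (N+1) T`, `K_t = P.transitionKernel (N+1) T T t⁺`, the mean forecast
`v_t = fcast … N t = K_t p_N`, its norm `S_N(t) = fnorm … N t = ‖v_t‖²_{L²(μ₀)}` and the pair correlation
`r_N(t) = pairCorr … N t = ⟨p_0, v_t⟩_{μ₀}` (`Theorems/PhononMeanFreePathDefs`).

The TIME-REVERSAL STRUCTURE of the forecast. The generator satisfies `L* = Θ L Θ` (`Θ(q,p) = (q,-p)`); at the
level of the semigroup this is the kernel detailed balance `∫ f · (K_s h) dμ₀ = ∫ (h∘Θ) · K_s (f∘Θ) dμ₀`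
(`SubdiffusiveBondHeat.pinnedChain_detailedBalance`). With Chapman–Kolmogorov `v_{s+u} = K_s v_u`
(`timeReversal_fcast_add`) and `p_N ∘ Θ = -p_N`:

* `echo_timeReversal` — `a_N(s+u) = ⟨p_N, v_{s+u}⟩ = -⟨v_u∘Θ, v_s⟩`;
* `pairCorr_timeReversal` — `r_N(s+u) = -⟨v_u∘Θ, K_s p_0⟩`;
* `abs_echo_two_mul_le_fnorm` — `|a_N(2t)| ≤ S_N(t)` (AM–GM, `‖v∘Θ‖ = ‖v‖` since `Θ` preserves `μ₀`);
* `pairCorr_sq_le_fnorm_mul_leftNorm` — `r_N(s+u)² ≤ S_N(u) · ‖K_s p_0‖²` (Cauchy–Schwarz in `L²(μ₀)`).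
-/

noncomputable section

namespace Summit.AtomisticToContinuum.FouriersLaw.Theorems.PhononMeanFreePath

open MeasureTheory Set Filter Topology
open scoped NNReal
open Literature.MathematicalPhysics.KineticTheory.HeatConduction
open Summit.AtomisticToContinuum.FouriersLaw.Theorems.SubdiffusiveBondHeat
  (pinnedChain_detailedBalance pinnedChain_sq_act_le_of_sq_integrable abs_integral_mul_le_weighted)
open Summit.AtomisticToContinuum.FouriersLaw.Theorems.IncoherentChannel.Negative.KernelMoments
  (integrable_momentum_transitionKernel)
open Summit.AtomisticToContinuum.FouriersLaw.Cruxes.SuperadditiveResistance.FloatingProbeBypassLaplacian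
  (integral_flip_gibbsMeasure integrable_flip_gibbsMeasure)

/-! ### Two elementary tools -/

/-- **Cauchy–Schwarz under the integral**: `(∫ a b dμ)² ≤ (∫ a² dμ)(∫ b² dμ)` for `a², b² ∈ L¹(μ)`
(discriminant of `ε ↦ ε² ∫a² - 2ε|∫ab| + ∫b² ≥ 0`, from the weighted AM–GM bound). [folklore] -/
theorem timeReversal_sq_integral_mul_le {n : ℕ} {μ : Measure (PhaseSpace n)} {a b : PhaseSpace n → ℝ}
    (ha : Integrable (fun z => a z ^ 2) μ) (hb : Integrable (fun z => b z ^ 2) μ) :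
    (∫ z, a z * b z ∂μ) ^ 2 ≤ (∫ z, a z ^ 2 ∂μ) * ∫ z, b z ^ 2 ∂μ := by
  have hA : 0 ≤ ∫ z, a z ^ 2 ∂μ := integral_nonneg fun _ => sq_nonneg _
  have hB : 0 ≤ ∫ z, b z ^ 2 ∂μ := integral_nonneg fun _ => sq_nonneg _
  have key : ∀ ε : ℝ, 0 ≤ (∫ z, a z ^ 2 ∂μ) * (ε * ε) + (-(2 * |∫ z, a z * b z ∂μ|)) * ε + ∫ z, b z ^ 2 ∂μ := by
    intro ε
    rcases le_or_gt ε 0 with hε | hε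
    · nlinarith [abs_nonneg (∫ z, a z * b z ∂μ), mul_nonneg hA (mul_self_nonneg ε)]
    · have h := abs_integral_mul_le_weighted ha hb hε
      have h3 : ε * ((ε * ∫ z, a z ^ 2 ∂μ + ε⁻¹ * ∫ z, b z ^ 2 ∂μ) / 2) =
          ((∫ z, a z ^ 2 ∂μ) * (ε * ε) + ∫ z, b z ^ 2 ∂μ) / 2 := by
        field_simp
      nlinarith [mul_le_mul_of_nonneg_left h hε.le]
  have hd := discrim_le_zero key
  rw [discrim] at hd
  nlinarith [sq_abs (∫ z, a z * b z ∂μ)]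

section Setting

variable {ω₂ lam β γ T : ℝ} (hω : 0 < ω₂) (hl : 0 ≤ lam) (hβ : 0 ≤ β) (hγ : 0 ≤ γ) (hT : 0 < T)
include hω hl hβ hγ hT

/-- **Chapman–Kolmogorov for the mean forecast**, pointwise: `v_{s+u}(z) = (K_s v_u)(z)` for every microstate `z`
and `s, u ≥ 0` (`K_{s+u} = K_u ∘ₖ K_s`, `pinnedChain_transitionKernel_add`, and `p_N ∈ L¹(K_{s+u} z)`). [folklore] -/
theorem timeReversal_fcast_add (N : ℕ) {s u : ℝ} (hs : 0 ≤ s) (hu : 0 ≤ u) (z : PhaseSpace (N + 1)) :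
    fcast ω₂ lam β γ T N (s + u) z =
      ∫ y, fcast ω₂ lam β γ T N u y ∂((pinnedChain ω₂ lam β γ).transitionKernel (N + 1) T T s.toNNReal z) := by
  unfold fcast
  rw [Real.toNNReal_add hs hu, pinnedChain_transitionKernel_add hω hl hβ hγ (N + 1) T T s.toNNReal u.toNNReal]
  refine ProbabilityTheory.Kernel.integral_comp ?_
  rw [← pinnedChain_transitionKernel_add hω hl hβ hγ (N + 1) T T s.toNNReal u.toNNReal]
  exact integrable_momentum_transitionKernel hω hl hβ hγ (Nat.succ_pos N) hT _ z _

end Setting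

/-! ### The registered stubs -/

/-- **Echo identity (registered stub `echo_timeReversal`).** For the pinned chain with both baths at `T`:
`⟨p_N, v_{s+u}⟩_{μ₀} = -⟨v_u∘Θ, v_s⟩_{μ₀}` for all `s, u ≥ 0` — Chapman–Kolmogorov `v_{s+u} = K_s v_u`, kernel
detailed balance with `f = p_N`, `h = v_u`, and `p_N∘Θ = -p_N`. [folklore] -/
theorem echo_timeReversal : ∀ ω₂ lam β γ : ℝ, 0 < ω₂ → 0 < lam → 0 < β → 0 < γ → ∀ T : ℝ, 0 < T → ∀ N : ℕ, 1 ≤ N → ∀ s u : ℝ, 0 ≤ s → 0 ≤ u → ∫ z, z.2 (Fin.last N) * fcast ω₂ lam β γ T N (s + u) z ∂((pinnedChain ω₂ lam β γ).gibbsMeasure (N + 1) T) = -∫ z, fcast ω₂ lam β γ T N u (z.1, -z.2) * fcast ω₂ lam β γ T N s z ∂((pinnedChain ω₂ lam β γ).gibbsMeasure (N + 1) T) := by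
  intro ω₂ lam β γ hω hl hβ hγ T hT N _ s u hs hu
  have hpm : Measurable fun z : PhaseSpace (N + 1) => z.2 (Fin.last N) :=
    (measurable_pi_apply (Fin.last N)).comp measurable_snd
  have hp2 : Integrable (fun z : PhaseSpace (N + 1) => z.2 (Fin.last N) ^ 2)
      ((pinnedChain ω₂ lam β γ).gibbsMeasure (N + 1) T) :=
    lightCone_integrable_momentum_pow hω hl.le hβ.le hT (Fin.last N) 2
  have hvm : Measurable (fcast ω₂ lam β γ T N u) := lightCone_measurable_fcast ω₂ lam β γ T N u
  have hv2 := (lightCone_fcast_moments ω₂ lam β γ hω hl.le hβ.le hγ.le T hT N u).2.1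
  calc ∫ z, z.2 (Fin.last N) * fcast ω₂ lam β γ T N (s + u) z ∂((pinnedChain ω₂ lam β γ).gibbsMeasure (N + 1) T)
      = ∫ z, z.2 (Fin.last N) * (∫ y, fcast ω₂ lam β γ T N u y
          ∂((pinnedChain ω₂ lam β γ).transitionKernel (N + 1) T T s.toNNReal z))
          ∂((pinnedChain ω₂ lam β γ).gibbsMeasure (N + 1) T) := by
        simp_rw [timeReversal_fcast_add hω hl.le hβ.le hγ.le hT N hs hu]
    _ = ∫ z, fcast ω₂ lam β γ T N u (z.1, -z.2) * (∫ y, (fun y : PhaseSpace (N + 1) => y.2 (Fin.last N)) (y.1, -y.2)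
          ∂((pinnedChain ω₂ lam β γ).transitionKernel (N + 1) T T s.toNNReal z))
          ∂((pinnedChain ω₂ lam β γ).gibbsMeasure (N + 1) T) :=
        pinnedChain_detailedBalance hω hl hβ hγ (Nat.succ_pos N) hT hpm hvm hp2 hv2 s.toNNReal
    _ = -∫ z, fcast ω₂ lam β γ T N u (z.1, -z.2) * fcast ω₂ lam β γ T N s z
          ∂((pinnedChain ω₂ lam β γ).gibbsMeasure (N + 1) T) := by
        rw [← integral_neg]
        refine integral_congr_ae (Eventually.of_forall fun z => ?_)
        simp only [Pi.neg_apply, integral_neg, fcast]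
        ring

/-- **Time reversal of the pair correlation (registered stub `pairCorr_timeReversal`).**
`r_N(s+u) = ⟨p_0, K_s v_u⟩_{μ₀} = -⟨v_u∘Θ, K_s p_0⟩_{μ₀}` for all `s, u ≥ 0` (Chapman–Kolmogorov, kernel detailed
balance with `f = p_0`, `h = v_u`, and `p_0∘Θ = -p_0`). [folklore] -/
theorem pairCorr_timeReversal : ∀ ω₂ lam β γ : ℝ, 0 < ω₂ → 0 < lam → 0 < β → 0 < γ → ∀ T : ℝ, 0 < T → ∀ N : ℕ, 1 ≤ N → ∀ s u : ℝ, 0 ≤ s → 0 ≤ u → pairCorr ω₂ lam β γ T N (s + u) = -∫ z, fcast ω₂ lam β γ T N u (z.1, -z.2) * (∫ y, y.2 0 ∂((pinnedChain ω₂ lam β γ).transitionKernel (N + 1) T T s.toNNReal z)) ∂((pinnedChain ω₂ lam β γ).gibbsMeasure (N + 1) T) := by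
  intro ω₂ lam β γ hω hl hβ hγ T hT N _ s u hs hu
  have hpm : Measurable fun z : PhaseSpace (N + 1) => z.2 0 := (measurable_pi_apply 0).comp measurable_snd
  have hp2 : Integrable (fun z : PhaseSpace (N + 1) => z.2 0 ^ 2) ((pinnedChain ω₂ lam β γ).gibbsMeasure (N + 1) T) :=
    lightCone_integrable_momentum_pow hω hl.le hβ.le hT 0 2
  have hvm : Measurable (fcast ω₂ lam β γ T N u) := lightCone_measurable_fcast ω₂ lam β γ T N u
  have hv2 := (lightCone_fcast_moments ω₂ lam β γ hω hl.le hβ.le hγ.le T hT N u).2.1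
  unfold pairCorr
  calc ∫ z, z.2 0 * fcast ω₂ lam β γ T N (s + u) z ∂((pinnedChain ω₂ lam β γ).gibbsMeasure (N + 1) T)
      = ∫ z, z.2 0 * (∫ y, fcast ω₂ lam β γ T N u y
          ∂((pinnedChain ω₂ lam β γ).transitionKernel (N + 1) T T s.toNNReal z))
          ∂((pinnedChain ω₂ lam β γ).gibbsMeasure (N + 1) T) := by
        simp_rw [timeReversal_fcast_add hω hl.le hβ.le hγ.le hT N hs hu]
    _ = ∫ z, fcast ω₂ lam β γ T N u (z.1, -z.2) * (∫ y, (fun y : PhaseSpace (N + 1) => y.2 0) (y.1, -y.2)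
          ∂((pinnedChain ω₂ lam β γ).transitionKernel (N + 1) T T s.toNNReal z))
          ∂((pinnedChain ω₂ lam β γ).gibbsMeasure (N + 1) T) :=
        pinnedChain_detailedBalance hω hl hβ hγ (Nat.succ_pos N) hT hpm hvm hp2 hv2 s.toNNReal
    _ = -∫ z, fcast ω₂ lam β γ T N u (z.1, -z.2) * (∫ y, y.2 0
          ∂((pinnedChain ω₂ lam β γ).transitionKernel (N + 1) T T s.toNNReal z))
          ∂((pinnedChain ω₂ lam β γ).gibbsMeasure (N + 1) T) := by
        rw [← integral_neg]
        refine integral_congr_ae (Eventually.of_forall fun z => ?_)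
        simp only [Pi.neg_apply, integral_neg]
        ring

/-- **Echo bound (registered stub `abs_echo_two_mul_le_fnorm`).** `|⟨p_N, v_{2t}⟩_{μ₀}| ≤ S_N(t)` for `t ≥ 0`:
the echo identity at `s = u = t` and AM–GM `|∫ (v_t∘Θ) v_t| ≤ (‖v_t∘Θ‖² + ‖v_t‖²)/2 = S_N(t)` (`Θ` preserves
`μ₀`). [folklore] -/
theorem abs_echo_two_mul_le_fnorm : ∀ ω₂ lam β γ : ℝ, 0 < ω₂ → 0 < lam → 0 < β → 0 < γ → ∀ T : ℝ, 0 < T → ∀ N : ℕ, 1 ≤ N → ∀ t : ℝ, 0 ≤ t → |∫ z, z.2 (Fin.last N) * fcast ω₂ lam β γ T N (2 * t) z ∂((pinnedChain ω₂ lam β γ).gibbsMeasure (N + 1) T)| ≤ fnorm ω₂ lam β γ T N t := by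
  intro ω₂ lam β γ hω hl hβ hγ T hT N hN t ht
  rw [two_mul, echo_timeReversal ω₂ lam β γ hω hl hβ hγ T hT N hN t t ht ht, abs_neg]
  have hv2 := (lightCone_fcast_moments ω₂ lam β γ hω hl.le hβ.le hγ.le T hT N t).2.1
  have hvΘ2 : Integrable (fun z : PhaseSpace (N + 1) => fcast ω₂ lam β γ T N t (z.1, -z.2) ^ 2)
      ((pinnedChain ω₂ lam β γ).gibbsMeasure (N + 1) T) :=
    integrable_flip_gibbsMeasure (pinnedChain ω₂ lam β γ) (N + 1) T (F := fun z => fcast ω₂ lam β γ T N t z ^ 2) hv2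
  have h := abs_integral_mul_le_weighted hvΘ2 hv2 one_pos
  rw [inv_one, one_mul, one_mul,
    integral_flip_gibbsMeasure (pinnedChain ω₂ lam β γ) (N + 1) T (fun z => fcast ω₂ lam β γ T N t z ^ 2)] at h
  unfold fnorm
  linarith

/-- **Cauchy–Schwarz form of the reversed pair correlation (registered stub `pairCorr_sq_le_fnorm_mul_leftNorm`).**
`r_N(s+u)² ≤ S_N(u) · ∫ (K_s p_0)² dμ₀` for `s, u ≥ 0`: `pairCorr_timeReversal`, Cauchy–Schwarz in `L²(μ₀)` and
`‖v_u∘Θ‖ = ‖v_u‖` (`Θ` preserves `μ₀`); `(K_s p_0)² ∈ L¹(μ₀)` by the `L²`-contraction of `K_s`. [folklore] -/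
theorem pairCorr_sq_le_fnorm_mul_leftNorm : ∀ ω₂ lam β γ : ℝ, 0 < ω₂ → 0 < lam → 0 < β → 0 < γ → ∀ T : ℝ, 0 < T → ∀ N : ℕ, 1 ≤ N → ∀ s u : ℝ, 0 ≤ s → 0 ≤ u → (pairCorr ω₂ lam β γ T N (s + u)) ^ 2 ≤ fnorm ω₂ lam β γ T N u * ∫ z, (∫ y, y.2 0 ∂((pinnedChain ω₂ lam β γ).transitionKernel (N + 1) T T s.toNNReal z)) ^ 2 ∂((pinnedChain ω₂ lam β γ).gibbsMeasure (N + 1) T) := by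
  intro ω₂ lam β γ hω hl hβ hγ T hT N hN s u hs hu
  rw [pairCorr_timeReversal ω₂ lam β γ hω hl hβ hγ T hT N hN s u hs hu, neg_sq]
  have hv2 := (lightCone_fcast_moments ω₂ lam β γ hω hl.le hβ.le hγ.le T hT N u).2.1
  have hvΘ2 : Integrable (fun z : PhaseSpace (N + 1) => fcast ω₂ lam β γ T N u (z.1, -z.2) ^ 2)
      ((pinnedChain ω₂ lam β γ).gibbsMeasure (N + 1) T) :=
    integrable_flip_gibbsMeasure (pinnedChain ω₂ lam β γ) (N + 1) T (F := fun z => fcast ω₂ lam β γ T N u z ^ 2) hv2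
  have hpm : Measurable fun z : PhaseSpace (N + 1) => z.2 0 := (measurable_pi_apply 0).comp measurable_snd
  have hp2 : Integrable (fun z : PhaseSpace (N + 1) => z.2 0 ^ 2) ((pinnedChain ω₂ lam β γ).gibbsMeasure (N + 1) T) :=
    lightCone_integrable_momentum_pow hω hl.le hβ.le hT 0 2
  obtain ⟨-, hG2, -⟩ := pinnedChain_sq_act_le_of_sq_integrable hω hl hβ hγ (Nat.succ_pos N) hT hpm hp2 s.toNNReal
  have hcs := timeReversal_sq_integral_mul_le hvΘ2 hG2
  rw [integral_flip_gibbsMeasure (pinnedChain ω₂ lam β γ) (N + 1) T (fun z => fcast ω₂ lam β γ T N u z ^ 2)] at hcs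
  exact hcs

end Summit.AtomisticToContinuum.FouriersLaw.Theorems.PhononMeanFreePath

end
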